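import Summits.BirchSwinnertonDyer.BirchSwinnertonDyer.Theorems.ThetaPartnerAtTwoSignedKatoUpToAtTwoLayerPairingCompat
import Literature.NumberTheory.EllipticCurves.CyclotomicLayerTatePairingAdic
import HarnessLib

/-!
# Level compatibility `ℤ/p^{k+1} → ℤ/p^k` of the `ρ`-coefficient layer Tate pairings (`hcompat` of `CyclotomicLayer.rhoLayerPairingAdic`; K-b)

Route `ResidualThetaTransportAtTwo` (RTT), crux RSL_g `ResidualSignedLambdaLowerCMAtTwo` (stmt-BirchSwinnertonDyer-22608); seat `prover-bsd-wall-rtt-p2` g16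
(`--supports`, closes nothing). The `ρ`-twin of `SignedKatoOffTwo.LayerPairing.layerPairingPk_succ_compat` (TP2, p = any, W any): for a
TOWER of pairing data `ePk k : A_ρ[p^k] × A_ρ[p^k] → μ_{p^k}` (`e_{k+1}(a,b)^p = e_k(pa, pb)`, kernel-supplied by
`ThetaTransport.exists_cofreeWedgeTower`, p675174) the finite-coefficient pairings `CyclotomicLayer.rhoLayerPairingPk … n k` (defn-rho g0, p673067)
are compatible along `ZMod p^{k+1} → ZMod p^k` — the hypothesis `hcompat` under which `CyclotomicLayer.rhoLayerPairingAdic … n hcompat`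
(p674128) IS the `ℤ_p`-valued `ρ`-coefficient local Tate pairing of the `n`-th layer. Of the six commuting squares of TP2's proof this FIRST
file supplies the `ρ`-specific ones: (1)+(2) reduction `T_ρ → A_ρ[p^k]` followed by localisation (`layerLocOf_reduce_succ`), (2) generic naturality
of `layerLocOf` in the coefficients, (4) the Θ-transported Kummer classes (`cohomologyMap_cofreeTorsionLocalPow_thetaLayerKummer`); the generic
squares (3) Shapiro (`shapiroLift_cohomologyMap`), (5) summed cup products (`ContPairing.cupProduct_coindFin_map`), (6) THE invariant maps
(`invAt_cohomologyMap_muLocalPow`, TP2) and the assembly `rhoLayerPairingPk_succ_compat` are the sequel (K-b2).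
Definitions with bodies (`cofreeTorsionPow`, `cofreeTorsionLocalPow` — the maps `[p] : A_ρ[p^{k+1}] → A_ρ[p^k]` as morphisms of `TopRep`s)
and theorems; no named fact, no instance, no `sorry`. BSD is not proved by any of this.

References: [Kato2004Asterisque] §13.8 (pp. 228–229), §14.9; [PerrinRiou1994Invent] §3.6.1; [Kobayashi2003] (8.23); [SerreLocalFields1979] XIII §3;
[NeukirchSchmidtWingberg2008] I §4 (1.4.2), I §6 (1.6.4).
-/

set_option autoImplicit false
-- the Theorems namespace of this sub repeats the summit name by design (D-0017 nested layout)
set_option linter.dupNamespace false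

noncomputable section

open scoped Classical

namespace Summit.BirchSwinnertonDyer.BirchSwinnertonDyer.Theorems.ThetaTransport

open CategoryTheory Field NumberField IsDedekindDomain WeierstrassCurve
  Literature.NumberTheory.EllipticCurves Literature.NumberTheory.GaloisRepresentations
  Literature.NumberTheory.EllipticCurves.Kobayashi2003 Literature.NumberTheory.EllipticCurves.Sprung2012
  Literature.NumberTheory.EllipticCurves.GreenbergSelmer Literature.NumberTheory.EllipticCurves.CyclotomicLayer
  Literature.NumberTheory.GaloisCohomology ZpExtension

attribute [local instance] absoluteGaloisGroup_compactSpace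

variable {p : ℕ} [Fact p.Prime] (S : Set (PadicAlgCl p)) {d : ℕ} (ρ : FramedGaloisRep ℚ ↥(padicCoeffIntegers S) d) (k : ℕ)

/-! ## §1 `[p] : A_ρ[p^{k+1}] ⟶ A_ρ[p^k]` -/

/-- `p • a ∈ A_ρ[p^k]` for `a ∈ A_ρ[p^{k+1}]`. [cite: Kato2004Asterisque, §13.8 (p. 228)] -/
theorem zsmul_mem_cofreeTorsionBy_pow (a : ↥(AddSubgroup.torsionBy (Cofree ρ ↥(padicCoeffField S)) ((p ^ (k + 1) : ℕ) : ℤ))) :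
    (p : ℤ) • (a : Cofree ρ ↥(padicCoeffField S)) ∈ AddSubgroup.torsionBy (Cofree ρ ↥(padicCoeffField S)) ((p ^ k : ℕ) : ℤ) := by
  refine (Submodule.mem_torsionBy_iff (R := ℤ) _ _).mpr ?_
  rw [smul_smul]
  have h : (((p ^ k : ℕ) : ℤ) * (p : ℤ)) = ((p ^ (k + 1) : ℕ) : ℤ) := by push_cast; ring
  rw [h]
  exact (Submodule.mem_torsionBy_iff (R := ℤ) _ _).mp a.2

/-- **`[p] : A_ρ[p^{k+1}] ⟶ A_ρ[p^k]`** as a morphism of the discrete `Γ_ℚ`-modules (`ρ`-twin of TP2's `torsionPow`).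
[cite: Kato2004Asterisque, §13.8 (p. 228)] -/
def cofreeTorsionPow :
    (cofreeTorsionGaloisModule S ρ ((p ^ (k + 1) : ℕ) : ℤ)).toTopRep ⟶ (cofreeTorsionGaloisModule S ρ ((p ^ k : ℕ) : ℤ)).toTopRep :=
  TopRep.ofHom
    { toContinuousLinearMap :=
        { toFun := fun a ↦ ⟨(p : ℤ) • (a : Cofree ρ ↥(padicCoeffField S)), zsmul_mem_cofreeTorsionBy_pow S ρ k a⟩
          map_add' := fun a b ↦ Subtype.ext (by
            change (p : ℤ) • ((a : Cofree ρ ↥(padicCoeffField S)) + (b : Cofree ρ ↥(padicCoeffField S))) =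
              (p : ℤ) • (a : Cofree ρ ↥(padicCoeffField S)) + (p : ℤ) • (b : Cofree ρ ↥(padicCoeffField S))
            rw [zsmul_add])
          map_smul' := fun c a ↦ Subtype.ext (by
            change (p : ℤ) • (c • (a : Cofree ρ ↥(padicCoeffField S))) = c • ((p : ℤ) • (a : Cofree ρ ↥(padicCoeffField S)))
            rw [smul_comm])
          cont := continuous_of_discreteTopology }
      isIntertwining' := fun σ ↦ by
        ext a
        change (p : ℤ) • ((cofreeTorsionGaloisModule S ρ _ σ a : ↥(AddSubgroup.torsionBy _ _)) : Cofree ρ ↥(padicCoeffField S)) =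
          σ • ((p : ℤ) • (a : Cofree ρ ↥(padicCoeffField S)))
        rw [cofreeTorsionGaloisModule_apply_apply, Literature.NumberTheory.EllipticCurves.AddSubgroup.torsionBy.coe_smul]
        exact (map_zsmul (DistribSMul.toAddMonoidHom (Cofree ρ ↥(padicCoeffField S)) σ) (p : ℤ) (a : Cofree ρ ↥(padicCoeffField S))).symm }

/-- Values of `cofreeTorsionPow`: `a ↦ p • a`. [cite: Kato2004Asterisque, §13.8 (p. 228)] -/
@[simp] theorem coe_cofreeTorsionPow_apply (a : ↥(AddSubgroup.torsionBy (Cofree ρ ↥(padicCoeffField S)) ((p ^ (k + 1) : ℕ) : ℤ))) :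
    (((cofreeTorsionPow S ρ k).hom a : ↥(AddSubgroup.torsionBy (Cofree ρ ↥(padicCoeffField S)) ((p ^ k : ℕ) : ℤ))) :
      Cofree ρ ↥(padicCoeffField S)) = (p : ℤ) • (a : Cofree ρ ↥(padicCoeffField S)) := rfl

variable (v : HeightOneSpectrum (𝓞 ℚ))

/-- **`[p]` on the local coefficient modules** `A_ρ[p^{k+1}]|_{Γ_v} ⟶ A_ρ[p^k]|_{Γ_v}`. [cite: Kato2004Asterisque, §13.8 (p. 228)] -/
def cofreeTorsionLocalPow : cofreeTorsionLocalRep S ρ ((p ^ (k + 1) : ℕ) : ℤ) v ⟶ cofreeTorsionLocalRep S ρ ((p ^ k : ℕ) : ℤ) v :=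
  TopRep.ofHom ((cofreeTorsionPow S ρ k).hom.restrictField (v.adicCompletion ℚ))

/-- Values of `cofreeTorsionLocalPow`. [cite: Kato2004Asterisque, §13.8 (p. 228)] -/
@[simp] theorem coe_cofreeTorsionLocalPow_apply (a : ↥(AddSubgroup.torsionBy (Cofree ρ ↥(padicCoeffField S)) ((p ^ (k + 1) : ℕ) : ℤ))) :
    (((cofreeTorsionLocalPow S ρ k v).hom a : ↥(AddSubgroup.torsionBy (Cofree ρ ↥(padicCoeffField S)) ((p ^ k : ℕ) : ℤ))) :
      Cofree ρ ↥(padicCoeffField S)) = (p : ℤ) • (a : Cofree ρ ↥(padicCoeffField S)) := rfl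

/-! ## §2 The squares (1) reduction, (2) localisation, (4) Θ-Kummer -/

/-- **(2) Localisation is natural in the coefficients** (generic coefficient modules): `loc ∘ f_* = f_* ∘ loc`.
[cite: Kobayashi2003, (8.23) (p. 18)] -/
theorem layerLocOf_cohomologyMap {M M' : Type} [AddCommGroup M] [TopologicalSpace M] [DiscreteTopology M]
    [AddCommGroup M'] [TopologicalSpace M'] [DiscreteTopology M'] (ρM : DiscreteGaloisModule ℚ M) (ρM' : DiscreteGaloisModule ℚ M')
    (f : ρM.toTopRep ⟶ ρM'.toTopRep) (κ : ZpExtension ℚ p) (n : ℕ) (y : H1 ρM (κ.layerSubgroup n)) :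
    layerLocOf ρM' κ v n (cohomologyMap (subgroupRepMap f (κ.layerSubgroup n)) 1 y) =
      cohomologyMap (subgroupRepMap (Y := localRepOf ρM' v) (TopRep.ofHom (f.hom.restrictField (v.adicCompletion ℚ))) (layerGroup κ v n)) 1
        (layerLocOf ρM κ v n y) := by
  obtain ⟨φ, rfl⟩ := oneCocycleClass_surjective _ y
  unfold layerLocOf
  rw [cohomologyMap_oneCocycleClass, map_oneCocycleClass, map_oneCocycleClass, cohomologyMap_oneCocycleClass]
  congr 1

/-- `loc_n` on explicit cocycles (generic coefficient module): the class of `φ ∘ (U_n → Γ_n)`. [cite: Kobayashi2003, (8.23) (p. 18)] -/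
theorem layerLocOf_oneCocycleClass {M : Type} [AddCommGroup M] [TopologicalSpace M] [DiscreteTopology M]
    (ρM : DiscreteGaloisModule ℚ M) (κ : ZpExtension ℚ p) (n : ℕ) (φ : contOneCocycles (subgroupRep ρM.toTopRep (κ.layerSubgroup n))) :
    layerLocOf ρM κ v n (oneCocycleClass _ φ) =
      oneCocycleClass (subgroupRep (localRepOf ρM v) (layerGroup κ v n))
        (contOneCocycles.pullback (resGalSubgroupOfEmb (κ.layerSubgroup n) (closureEmb (K := ℚ) (v.adicCompletion ℚ)))
          (X := subgroupRep ρM.toTopRep (κ.layerSubgroup n)) (Y := subgroupRep (localRepOf ρM v) (layerGroup κ v n))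
          (TopRep.ofHom ⟨ContinuousLinearMap.id ℤ M, fun _ ↦ rfl⟩) φ) := by
  unfold layerLocOf
  rw [map_oneCocycleClass]

/-- `red_{p^k}` on explicit cocycles, READ IN THE `subgroupRep (cofreeTorsionGaloisModule …).toTopRep` DIALECT (the typer's `rfl` bridge
`discreteTopRep_cofreeTorsionBy_eq`): the same cocycle, pushed along `t ↦ p^{-k}t mod 𝒪ⁿ`. [cite: Kato2004Asterisque, §13.8 (p. 228)] -/
theorem reduceH1CofreePkTorsion_oneCocycleClass' (U : Subgroup (absoluteGaloisGroup ℚ))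
    (φ : contOneCocycles (subgroupRep (FramedGaloisRep.toGaloisRep ρ).toTopRep U)) :
    (reduceH1CofreePkTorsion S ρ k U (oneCocycleClass _ φ) : H1 (cofreeTorsionGaloisModule S ρ ((p ^ k : ℕ) : ℤ)) U) =
      oneCocycleClass (subgroupRep (cofreeTorsionGaloisModule S ρ ((p ^ k : ℕ) : ℤ)).toTopRep U)
        (contOneCocycles.pushAddHom (X := subgroupRep (FramedGaloisRep.toGaloisRep ρ).toTopRep U)
          (Y := subgroupRep (cofreeTorsionGaloisModule S ρ ((p ^ k : ℕ) : ℤ)).toTopRep U)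
          (divPowCofreeMkTorsion S ρ k) (continuous_divPowCofreeMkTorsion S ρ k) (divPowCofreeMkTorsion_subgroupRep S ρ k U) φ) :=
  reduceH1CofreePkTorsion_oneCocycleClass S ρ k U φ

set_option maxHeartbeats 3200000 in
-- two rewrites of `layerLocOf_oneCocycleClass` at the concrete module `A_ρ[p^k]` are slow to unify (instance paths of the torsion subtype)
/-- **(1)+(2) Reduction then localisation is compatible with `[p]`**: `loc_n(red_{p^k} x) = [p]_* loc_n(red_{p^{k+1}} x)` in
`H¹(U_n, A_ρ[p^k]|)` (`p · p^{-k-1}t = p^{-k}t`, `smul_divPowCofreeMk_succ`). [cite: Kato2004Asterisque, §13.8 (p. 228)] [cite: Kobayashi2003, (8.23) (p. 18)] -/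
theorem layerLocOf_reduce_succ (κ : ZpExtension ℚ p) (n : ℕ) (x : H1 (FramedGaloisRep.toGaloisRep ρ) (κ.layerSubgroup n)) :
    layerLocOf (cofreeTorsionGaloisModule S ρ ((p ^ k : ℕ) : ℤ)) κ v n (reduceH1CofreePkTorsion S ρ k (κ.layerSubgroup n) x) =
      cohomologyMap (subgroupRepMap (cofreeTorsionLocalPow S ρ k v) (layerGroup κ v n)) 1
        (layerLocOf (cofreeTorsionGaloisModule S ρ ((p ^ (k + 1) : ℕ) : ℤ)) κ v n (reduceH1CofreePkTorsion S ρ (k + 1) (κ.layerSubgroup n) x)) := by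
  obtain ⟨φ, rfl⟩ := oneCocycleClass_surjective _ x
  have h1 := reduceH1CofreePkTorsion_oneCocycleClass' S ρ k (κ.layerSubgroup n) φ
  have h2 := reduceH1CofreePkTorsion_oneCocycleClass' S ρ (k + 1) (κ.layerSubgroup n) φ
  -- both sides read in the `H1 (cofreeTorsionGaloisModule …)` dialect
  change layerLocOf (cofreeTorsionGaloisModule S ρ ((p ^ k : ℕ) : ℤ)) κ v n
      (reduceH1CofreePkTorsion S ρ k (κ.layerSubgroup n) (oneCocycleClass _ φ) : H1 (cofreeTorsionGaloisModule S ρ ((p ^ k : ℕ) : ℤ)) _) =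
    cohomologyMap (subgroupRepMap (cofreeTorsionLocalPow S ρ k v) (layerGroup κ v n)) 1
      (layerLocOf (cofreeTorsionGaloisModule S ρ ((p ^ (k + 1) : ℕ) : ℤ)) κ v n
        (reduceH1CofreePkTorsion S ρ (k + 1) (κ.layerSubgroup n) (oneCocycleClass _ φ) : H1 (cofreeTorsionGaloisModule S ρ ((p ^ (k + 1) : ℕ) : ℤ)) _))
  rw [h1, h2, layerLocOf_oneCocycleClass, layerLocOf_oneCocycleClass, cohomologyMap_oneCocycleClass]
  congr 1
  apply Subtype.ext
  ext g
  change (divPowCofreeMk S ρ k _ : Cofree ρ ↥(padicCoeffField S)) = (p : ℤ) • (divPowCofreeMk S ρ (k + 1) _ : Cofree ρ ↥(padicCoeffField S))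
  rw [natCast_zsmul, smul_divPowCofreeMk_succ]
  rfl

variable (W : WeierstrassCurve ℚ) [W.IsElliptic] {r : ℕ} (Θ : Cofree ρ ↥(padicCoeffField S) ≃+ (Fin r → ↥(W.geomPrimaryTorsion p)))
  (κ : ZpExtension ℚ p)
  (hΘ : ∀ (δ : absoluteGaloisGroup (v.adicCompletion ℚ)) (m : Cofree ρ ↥(padicCoeffField S)) (i : Fin r),
    Θ (resGalOfEmb (closureEmb (K := ℚ) (v.adicCompletion ℚ)) δ • m) i =
      resGalOfEmb (closureEmb (K := ℚ) (v.adicCompletion ℚ)) δ • Θ m i)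

omit [W.IsElliptic] in
/-- `p • Θ⁻¹(P·δ_i) = Θ⁻¹((pP)·δ_i)` on underlying points of `A_ρ`. [cite: Greenberg1989, §1 p. 98] -/
theorem zsmul_coe_thetaSingle_succ (i : Fin r) (P : geomTorsion W ((p ^ (k + 1) : ℕ) : ℤ)) :
    (p : ℤ) • ((thetaSingle ρ p (k + 1) W Θ i P : ↥(AddSubgroup.torsionBy (Cofree ρ ↥(padicCoeffField S)) ((p ^ (k + 1) : ℕ) : ℤ))) :
        Cofree ρ ↥(padicCoeffField S)) =
      ((thetaSingle ρ p k W Θ i ((Summit.BirchSwinnertonDyer.BirchSwinnertonDyer.Theorems.SignedKatoOffTwo.LayerPairing.torsionPow W k).hom P) : ↥(AddSubgroup.torsionBy (Cofree ρ ↥(padicCoeffField S)) ((p ^ k : ℕ) : ℤ))) :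
        Cofree ρ ↥(padicCoeffField S)) := by
  rw [coe_thetaSingle, coe_thetaSingle, ← map_zsmul]
  congr 1
  funext j
  apply Subtype.ext
  by_cases hj : j = i
  · subst hj
    simp only [Pi.smul_apply, Pi.single_eq_same, AddSubgroupClass.coe_zsmul]
    rfl
  · simp only [Pi.smul_apply, Pi.single_eq_of_ne hj, smul_zero]

omit [W.IsElliptic] in
/-- **(4a) `[p]_* ∘ (thetaSingle_{k+1} i)_* = (thetaSingle_k i)_* ∘ [p]_*`** on `H¹(U_n, ·)`. [cite: SerreGaloisCohomology1997, I §2.2] -/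
theorem cohomologyMap_cofreeTorsionLocalPow_thetaSingleH1 (i : Fin r) (n : ℕ)
    (c : continuousCohomology 1 (subgroupRep (torsionLocalRep W (p ^ (k + 1)) v) (layerGroup κ v n))) :
    cohomologyMap (subgroupRepMap (cofreeTorsionLocalPow S ρ k v) (layerGroup κ v n)) 1 (thetaSingleH1 S ρ (k + 1) W Θ κ v hΘ i n c) =
      thetaSingleH1 S ρ k W Θ κ v hΘ i n (cohomologyMap (subgroupRepMap (Summit.BirchSwinnertonDyer.BirchSwinnertonDyer.Theorems.SignedKatoOffTwo.LayerPairing.torsionLocalPow W v k) (layerGroup κ v n)) 1 c) := by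
  obtain ⟨φ, rfl⟩ := oneCocycleClass_surjective _ c
  rw [thetaSingleH1_oneCocycleClass, cohomologyMap_oneCocycleClass, cohomologyMap_oneCocycleClass, thetaSingleH1_oneCocycleClass]
  congr 1
  apply Subtype.ext
  ext g
  exact zsmul_coe_thetaSingle_succ S ρ k W Θ i (φ.1 g)

/-- **(4, `E`-side) `[p]_* κ_{U_n,p^{k+1}}(Q) = κ_{U_n,p^k}(Q)`** for the Literature-dialect `CyclotomicLayer.layerKummer` — TP2's
`SignedKatoOffTwo.LayerPairing.cohomologyMap_torsionLocalPow_layerKummer` read through the `rfl` bridge of the two dialects (parallel bodies).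
[cite: SilvermanAEC2009, VIII §2] -/
theorem cohomologyMap_torsionLocalPow_layerKummer (n : ℕ) (Q : ↥(localLayerPointsOfEmb κ (closureEmb (K := ℚ) (v.adicCompletion ℚ)) W n)) :
    cohomologyMap (subgroupRepMap (Summit.BirchSwinnertonDyer.BirchSwinnertonDyer.Theorems.SignedKatoOffTwo.LayerPairing.torsionLocalPow W v k) (layerGroup κ v n)) 1 (layerKummer W (p ^ (k + 1)) κ v n Q) =
      layerKummer W (p ^ k) κ v n Q :=
  Summit.BirchSwinnertonDyer.BirchSwinnertonDyer.Theorems.SignedKatoOffTwo.LayerPairing.cohomologyMap_torsionLocalPow_layerKummer W κ v k n Q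

set_option maxHeartbeats 800000 in
/-- **(4) The Θ-Kummer maps are compatible**: `[p]_* (thetaLayerKummer_{k+1} Q) = thetaLayerKummer_k Q` (TP2's
`cohomologyMap_torsionLocalPow_layerKummer` on each coordinate, and (4a)). [cite: Kobayashi2003, (8.23) (p. 18)] [cite: SilvermanAEC2009, VIII §2] -/
theorem cohomologyMap_cofreeTorsionLocalPow_thetaLayerKummer (n : ℕ)
    (Q : Fin r → ↥(localLayerPointsOfEmb κ (closureEmb (K := ℚ) (v.adicCompletion ℚ)) W n)) :
    cohomologyMap (subgroupRepMap (cofreeTorsionLocalPow S ρ k v) (layerGroup κ v n)) 1 (thetaLayerKummer S ρ (k + 1) W Θ κ v hΘ n Q) =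
      thetaLayerKummer S ρ k W Θ κ v hΘ n Q := by
  rw [thetaLayerKummer_apply, thetaLayerKummer_apply, map_sum]
  refine Finset.sum_congr rfl fun i _ ↦ ?_
  rw [cohomologyMap_cofreeTorsionLocalPow_thetaSingleH1, cohomologyMap_torsionLocalPow_layerKummer]

end Summit.BirchSwinnertonDyer.BirchSwinnertonDyer.Theorems.ThetaTransport

end
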